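import Literature.MathematicalPhysics.QuantumFieldTheory.Balaban1983to89.B6RandomWalkL2Gluing
import Literature.MathematicalPhysics.QuantumFieldTheory.Balaban1983to89.B6Lemma21Repaired

/-!
# `Balaban1983to89.B6RandomWalkL2ChainWith` — T. Bałaban, *Propagators and renormalization transformations for lattice gauge theories. II*,
# Commun. Math. Phys. **96** (1984) 223–250 [Balaban1984PropagatorsII], (2.64)–(2.66) p. 234, (2.91) p. 239 and (2.141) p. 247 IN THE `L²` NORMS OF
# (2.140), WITH LEMMA 2.1 IN ITS GENERIC-CONSTANT FORM `Ineq261With c` / `Ineq263With c` (the form the multi-level torus satisfies: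
# `…B6Geom246MultiLevelTorus.lemma21_torus`, constant `K261`) — the `ℓ²` twin of r03's `…B6Prop26ChainGeneric` (file 10 of the block-`ℓ²` bricks)

statement-level skeleton of published theorems with citation tags; proofs where landed; nothing here is a claim about the Yang–Mills mass gap

WHAT IS PRINTED (p. 234 [PDF 12]): *"|(Rⁿλ)(x)| ≤ (O(M^{−1})c₁)ⁿ e^{−½δ₀d(y,y′)}|λ|, (2.65) … |(G′λ)(x)| ≤ Σ_{n=0}^∞ |(G′₀Rⁿλ)(x)| ≤ … (2.66)"*; p. 247 [PDF 25]:
*"Reasoning in the same way as in the proof of Proposition 2.2 we obtain Proposition 2.6. … ‖ζ∇∇GJ‖, ‖ζG∇*∇*J‖ ≤ O(1)…e^{−δ₃d(y,y′)}|ζ|‖J‖ (2.140) …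
G = G₀(I − R)⁻¹ = Σ_{n=0}^∞ G₀Rⁿ (2.141) and the series above is convergent in the norms appearing in the inequalities (2.136)–(2.140)."*

CITATION HEADER (lean-in-tree rule) — WHAT IS REPRODUCED.  Phase-2 file of the `lit-balaban` typed skeleton (HOME `run/shared/lean/pub/lit-balaban/`),
seat **p22 gen 30** (free-target protocol G.5-34(d), TAKING HOME/STATUS 2026-08-24T13:26Z «block-ℓ² walk toward census (2.140)₄₋₆», cc r03); SKELETON row
**B6.Prop2.6** × B6.Eq2.141 × B6.Eq2.66 × B6.Lem2.1 (cells only; decls of record untouched).  WHY: `…B6RandomWalkL2Chain` / `…B6RandomWalkL2Gluing` hard-wire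
the PRINTED Lemma-2.1 constant `B6.c1 d δ α` (`B6RandomWalk.Ineq261/Ineq263`), exactly as pv08's sup-norm chain did; the genuine `(k+1)`-level torus
`geomT D` carries Lemma 2.1 only with the generic constant `K261 N₀ (d+1) L 1 (αδ)` (`lemma21_torus`; the printed `c₁` is refuted as printed for `d ≥ 3`,
`B6Lemma21Counterexample`, GAPS G-A11-1), so the k-level `L²` census slots need the chain with `c₁ ↦ c`, `0 ≤ c` — r03's `B6Prop26ChainGeneric` repair, in `ℓ²`.
The proofs are those of `…B6RandomWalkL2Chain` line by line; only the constant is a variable: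
* §1 `kernel_G0_conv_leW`, **`l2Majorant_pow_265W`**, **`l2Majorant_G0_mul_265W`**, **`l2Majorant_partialSum_266W`**, **`l2Majorant_of_fixedPoint_266W`**,
  **`prop26_chain_2140With`** (`G = G₀ + GR`, `HasL2Majorant G₀ (A·P·e^{−½δ₂d})`, `HasL2Majorant R (θe^{−½δ₂d})`, `Ineq261With c`, `Ineq263With c`, `θc < 1`
  ⟹ `HasL2Majorant G (A·c·(1 − θc)⁻¹·P·e^{−δ₃d})`);
* §2 the product-form pair input: **`hasL2Majorant_localise_in_of_mul`** (a block-`ℓ²` majorant of `T·h` with `supp h` over the blocks of `S′` localises its own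
  input: factor `1_{S′}(y′)`), **`l2Majorant_R_of_2134_mul`** ((2.134) ⟹ (2.135) in `L²` when the displayed pair bound is that of the PRODUCT `K_{□,□′}G_{□′}h_{□′}` —
  the shape p38's torus files `…B6Ineq2134KFamKLevelTorus` / `…B6Ineq2134TransposeKLevelTorus` deliver and `…B6RandomWalkL2Schur` converts);
* §3 **`prop26_2140_of_l2legsWith`** — END TO END with the generic constant: per-box `ℓ²` legs `1_{S_□}(y)·A·P(y)·e^{−½δ₂d}`, `ℓ²` pair bounds `θ₀e^{−½δ₂d}` of the
  products `K_{□,□′}G_{□′}h_{□′}` output-localised to `S_□`, overlap number `N`, `G = G₀ + GR`, `Ineq261With c`/`Ineq263With c`, `N²θ₀·c < 1` ⟹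
  `HasL2Majorant G ((N·A)·c·(1 − N²θ₀c)⁻¹·P(y)·e^{−δ₃d})`.
THEOREMS ONLY (no definition, no `def … : Prop`, no new hypothesis beyond the printed shapes); IMPORTS BY NAME; standard axioms.

HONEST SCOPE / DIVERGENCES.  (1) As `…B6RandomWalkL2Chain`: the block-`ℓ²` majorants of `G₀` and of the pair products are hypotheses of the printed shape;
(2) Lemma 2.1 enters with a generic constant `c ≥ 0` (print: `c₁(α) = 12c₀^d(½α)`); (3) unweighted `ℓ²` sums; bookkeeping toward the census slots (2.140)₄₋₆,
NOT those slots.  NOT summit progress.  Unit `lit-balaban-p22` (gen 30), 2026-08-24.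
-/

noncomputable section

open scoped BigOperators
open Finset

namespace Literature.MathematicalPhysics.QuantumFieldTheory.Balaban1983to89.B6RandomWalkL2ChainWith

open B6RandomWalk (blockPiece sum_blockPiece chain chain_zero chain_succ chain_nonneg chain_const_mul
  Triangle254 fixedPoint_telescope delta3)
open B6Lemma21Repaired (Ineq261With Ineq263With)
open B6RandomWalkL2 (l2n l2n_nonneg l2n_zero l2n_add_le l2n_sum_le l2n_mono l2n_blockPiece_le blockPiece_add HasL2Majorant
  hasL2Majorant_mono hasL2Majorant_sum hasL2Majorant_mul hasL2Majorant_pow_chain hasL2Majorant_one exists_l2OpBound l2n_apply_le_of_hasL2Majorant)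
open B6Prop26Gluing (mulOp mulOp_apply OutLoc ind ind_nonneg ind_le_one ind_of_mem ind_of_not_mem sum_ind_eq_card)
open B6RandomWalkL2Gluing (hasL2Majorant_mul_mulOp hasL2Majorant_localise_out mulOp_eq_zero_of_support hasL2Majorant_sum_pairs_overlap
  l2Majorant_G0_of_legs)

variable {g : B6.Geometry} {X : Type} [Fintype X]

/-! ## §1  (2.64)–(2.66) and Prop. 2.6's chain in `L²`, generic Lemma-2.1 constant -/

section ChainW

variable (blk : X → g.Site)

/-- the kernel step of (2.66) with a generic (2.61)-constant `c`: `Σ_{y″} A·P(a)·e^{−δ₀d(a,y″)}·(r·e^{−(1−α)δ₀d(y″,b)}) ≤ A·c·P(a)·r·e^{−(1−α)δ₀d(a,b)}`.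
[cite: Balaban1984PropagatorsII, (2.66) p.234 with (2.54) p.233, (2.61) p.234] -/
theorem kernel_G0_conv_leW (c δ₀ α A r : ℝ) (P : g.Site → ℝ) (hA : 0 ≤ A) (hP : ∀ y, 0 ≤ P y) (hr : 0 ≤ r)
    (hαδ : 0 ≤ (1 - α) * δ₀) (htri : Triangle254 g) (h261 : Ineq261With c g δ₀ α) (a b : g.Site) :
    ∑ y'' : g.Site, A * P a * Real.exp (-(δ₀ * g.dist a y'')) * (r * Real.exp (-((1 - α) * δ₀ * g.dist y'' b))) ≤
      A * c * P a * r * Real.exp (-((1 - α) * δ₀ * g.dist a b)) := by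
  have hterm : ∀ y'' : g.Site,
      A * P a * Real.exp (-(δ₀ * g.dist a y'')) * (r * Real.exp (-((1 - α) * δ₀ * g.dist y'' b))) ≤
        A * P a * r * Real.exp (-((1 - α) * δ₀ * g.dist a b)) * Real.exp (-(α * δ₀ * g.dist a y'')) := by
    intro y''
    have hexp : Real.exp (-(δ₀ * g.dist a y'')) * Real.exp (-((1 - α) * δ₀ * g.dist y'' b)) ≤
        Real.exp (-((1 - α) * δ₀ * g.dist a b)) * Real.exp (-(α * δ₀ * g.dist a y'')) := by
      rw [← Real.exp_add, ← Real.exp_add]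
      refine Real.exp_le_exp.mpr ?_
      have := mul_le_mul_of_nonneg_left (htri a y'' b) hαδ
      nlinarith
    have := mul_le_mul_of_nonneg_left hexp (mul_nonneg (mul_nonneg hA (hP a)) hr)
    calc A * P a * Real.exp (-(δ₀ * g.dist a y'')) * (r * Real.exp (-((1 - α) * δ₀ * g.dist y'' b)))
        = A * P a * r * (Real.exp (-(δ₀ * g.dist a y'')) * Real.exp (-((1 - α) * δ₀ * g.dist y'' b))) := by ring
      _ ≤ A * P a * r * (Real.exp (-((1 - α) * δ₀ * g.dist a b)) * Real.exp (-(α * δ₀ * g.dist a y''))) := this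
      _ = _ := by ring
  calc ∑ y'' : g.Site, A * P a * Real.exp (-(δ₀ * g.dist a y'')) * (r * Real.exp (-((1 - α) * δ₀ * g.dist y'' b)))
      ≤ ∑ y'' : g.Site, A * P a * r * Real.exp (-((1 - α) * δ₀ * g.dist a b)) *
          Real.exp (-(α * δ₀ * g.dist a y'')) := Finset.sum_le_sum fun y'' _ => hterm y''
    _ = A * P a * r * Real.exp (-((1 - α) * δ₀ * g.dist a b)) *
          ∑ y'' : g.Site, Real.exp (-(α * δ₀ * g.dist a y'')) := by rw [Finset.mul_sum]
    _ ≤ A * P a * r * Real.exp (-((1 - α) * δ₀ * g.dist a b)) * c :=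
        mul_le_mul_of_nonneg_left (h261 a)
          (mul_nonneg (mul_nonneg (mul_nonneg hA (hP a)) hr) (Real.exp_nonneg _))
    _ = A * c * P a * r * Real.exp (-((1 - α) * δ₀ * g.dist a b)) := by ring

/-- **(2.64) ⇒ (2.65) IN `L²`**, generic (2.63)-constant `c ≥ 0`: `Rⁿ` has the block-`ℓ²` majorant `(θc)ⁿe^{−(1−α)δ₀d(y,y′)}`.
[cite: Balaban1984PropagatorsII, (2.64)–(2.65) p.234, (2.141) p.247] -/
theorem l2Majorant_pow_265W (c δ₀ α θ : ℝ) (hθ : 0 ≤ θ)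
    (hrefl : ∀ y : g.Site, g.dist y y = 0) (h263 : Ineq263With c g δ₀ α)
    {R : Module.End ℝ (X → ℝ)} (hR : HasL2Majorant blk R (fun a b => θ * Real.exp (-(δ₀ * g.dist a b)))) (n : ℕ) :
    HasL2Majorant blk (R ^ n) (fun a b => (θ * c) ^ n * Real.exp (-((1 - α) * δ₀ * g.dist a b))) := by
  cases n with
  | zero =>
      rw [pow_zero]
      refine hasL2Majorant_one blk (fun y => ?_) (fun a b => by positivity)
      simp [hrefl y]
  | succ m =>
      have hK : ∀ a b : g.Site, 0 ≤ θ * Real.exp (-(δ₀ * g.dist a b)) := fun a b => mul_nonneg hθ (Real.exp_nonneg _)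
      refine hasL2Majorant_mono blk (hasL2Majorant_pow_chain blk hR hK m) fun a b => ?_
      rw [chain_const_mul, mul_pow, mul_assoc]
      exact mul_le_mul_of_nonneg_left (h263 m a b) (pow_nonneg hθ _)

/-- **One term of (2.66) IN `L²`**, generic constant: `G₀T` has the block-`ℓ²` majorant `A·c·P(y)·r·e^{−(1−α)δ₀d(y,y′)}`.
[cite: Balaban1984PropagatorsII, (2.66) p.234, (2.141) p.247] -/
theorem l2Majorant_G0_mul_265W (c δ₀ α A r : ℝ) (P : g.Site → ℝ) (hA : 0 ≤ A)
    (hP : ∀ y, 0 ≤ P y) (hr : 0 ≤ r) (hαδ : 0 ≤ (1 - α) * δ₀) (htri : Triangle254 g) (h261 : Ineq261With c g δ₀ α)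
    {G0 T : Module.End ℝ (X → ℝ)}
    (hG0 : HasL2Majorant blk G0 (fun a b => A * P a * Real.exp (-(δ₀ * g.dist a b))))
    (hT : HasL2Majorant blk T (fun a b => r * Real.exp (-((1 - α) * δ₀ * g.dist a b)))) :
    HasL2Majorant blk (G0 * T)
      (fun a b => A * c * P a * r * Real.exp (-((1 - α) * δ₀ * g.dist a b))) := by
  have hK₁ : ∀ a b : g.Site, 0 ≤ A * P a * Real.exp (-(δ₀ * g.dist a b)) := fun a b =>
    mul_nonneg (mul_nonneg hA (hP a)) (Real.exp_nonneg _)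
  exact hasL2Majorant_mono blk (hasL2Majorant_mul blk hG0 hT hK₁)
    (fun a b => kernel_G0_conv_leW c δ₀ α A r P hA hP hr hαδ htri h261 a b)

/-- **(2.66) IN `L²`, the partial sums**, generic constant `c ≥ 0`: every `Σ_{n<N}G₀Rⁿ` has the block-`ℓ²` majorant `A·c·(1 − θc)⁻¹·P(y)·e^{−(1−α)δ₀d}`
under the located smallness `θc < 1`. [cite: Balaban1984PropagatorsII, (2.66) p.234, (2.141) p.247] -/
theorem l2Majorant_partialSum_266W (c δ₀ α θ A : ℝ) (P : g.Site → ℝ) (hA : 0 ≤ A)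
    (hP : ∀ y, 0 ≤ P y) (hθ : 0 ≤ θ) (hc : 0 ≤ c) (hαδ : 0 ≤ (1 - α) * δ₀) (htri : Triangle254 g)
    (hrefl : ∀ y : g.Site, g.dist y y = 0) (h261 : Ineq261With c g δ₀ α) (h263 : Ineq263With c g δ₀ α)
    (hsmall : θ * c < 1) {G0 R : Module.End ℝ (X → ℝ)}
    (hG0 : HasL2Majorant blk G0 (fun a b => A * P a * Real.exp (-(δ₀ * g.dist a b))))
    (hR : HasL2Majorant blk R (fun a b => θ * Real.exp (-(δ₀ * g.dist a b)))) (N : ℕ) :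
    HasL2Majorant blk (∑ n ∈ Finset.range N, G0 * R ^ n)
      (fun a b => A * c * (1 - θ * c)⁻¹ * P a * Real.exp (-((1 - α) * δ₀ * g.dist a b))) := by
  set q : ℝ := θ * c with hq
  have hq0 : 0 ≤ q := mul_nonneg hθ hc
  have hterm : ∀ n, HasL2Majorant blk (G0 * R ^ n)
      (fun a b => A * c * P a * q ^ n * Real.exp (-((1 - α) * δ₀ * g.dist a b))) := fun n =>
    l2Majorant_G0_mul_265W blk c δ₀ α A (q ^ n) P hA hP (pow_nonneg hq0 n) hαδ htri h261 hG0
      (l2Majorant_pow_265W blk c δ₀ α θ hθ hrefl h263 hR n)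
  refine hasL2Majorant_mono blk (hasL2Majorant_sum blk (fun n => G0 * R ^ n) _ hterm N) fun a b => ?_
  have hgeom : ∑ n ∈ Finset.range N, q ^ n ≤ (1 - q)⁻¹ :=
    sum_le_hasSum (Finset.range N) (fun n _ => pow_nonneg hq0 n) (hasSum_geometric_of_lt_one hq0 hsmall)
  have hC : 0 ≤ A * c * P a * Real.exp (-((1 - α) * δ₀ * g.dist a b)) :=
    mul_nonneg (mul_nonneg (mul_nonneg hA hc) (hP a)) (Real.exp_nonneg _)
  calc ∑ n ∈ Finset.range N, A * c * P a * q ^ n * Real.exp (-((1 - α) * δ₀ * g.dist a b))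
      = A * c * P a * Real.exp (-((1 - α) * δ₀ * g.dist a b)) * ∑ n ∈ Finset.range N, q ^ n := by
        rw [Finset.mul_sum]; refine Finset.sum_congr rfl fun n _ => ?_; ring
    _ ≤ A * c * P a * Real.exp (-((1 - α) * δ₀ * g.dist a b)) * (1 - q)⁻¹ :=
        mul_le_mul_of_nonneg_left hgeom hC
    _ = _ := by ring

/-- **(2.66) ⇒ the operator itself, IN `L²`**, generic constant: every `G′` with `G′ = G′₀ + G′R` has the block-`ℓ²` majorant
`A·c·(1 − θc)⁻¹·P(y)·e^{−(1−α)δ₀d(y,y′)}` (the remainder `G′R^N → 0` in `ℓ²`). [cite: Balaban1984PropagatorsII, (2.66) p.234, (2.141) p.247] -/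
theorem l2Majorant_of_fixedPoint_266W [DecidableEq X] (c δ₀ α θ A : ℝ) (P : g.Site → ℝ)
    (hA : 0 ≤ A) (hP : ∀ y, 0 ≤ P y) (hθ : 0 ≤ θ) (hc : 0 ≤ c) (hαδ : 0 ≤ (1 - α) * δ₀) (htri : Triangle254 g)
    (hrefl : ∀ y : g.Site, g.dist y y = 0) (hdnn : ∀ y y' : g.Site, 0 ≤ g.dist y y')
    (h261 : Ineq261With c g δ₀ α) (h263 : Ineq263With c g δ₀ α) (hsmall : θ * c < 1)
    {G' G0 R : Module.End ℝ (X → ℝ)}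
    (hG0 : HasL2Majorant blk G0 (fun a b => A * P a * Real.exp (-(δ₀ * g.dist a b))))
    (hR : HasL2Majorant blk R (fun a b => θ * Real.exp (-(δ₀ * g.dist a b)))) (hfix : G' = G0 + G' * R) :
    HasL2Majorant blk G'
      (fun a b => A * c * (1 - θ * c)⁻¹ * P a * Real.exp (-((1 - α) * δ₀ * g.dist a b))) := by
  intro y y' u hu
  obtain ⟨E, hE, hEb⟩ := exists_l2OpBound G'
  set q : ℝ := θ * c with hq
  have hq0 : 0 ≤ q := mul_nonneg hθ hc
  set C : ℝ := A * c * (1 - q)⁻¹ * P y * Real.exp (-((1 - α) * δ₀ * g.dist y y')) * l2n u with hC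
  set S : ℝ := (Fintype.card g.Site : ℝ) with hS
  have hN : ∀ N : ℕ, l2n (blockPiece blk y (G' u)) ≤ C + E * S * l2n u * q ^ N := by
    intro N
    have hSum := l2Majorant_partialSum_266W blk c δ₀ α θ A P hA hP hθ hc hαδ htri hrefl h261 h263 hsmall hG0 hR N y y' u hu
    have hRN := l2Majorant_pow_265W blk c δ₀ α θ hθ hrefl h263 hR N
    have hglob : l2n ((R ^ N) u) ≤ S * q ^ N * l2n u := by
      have h1 := l2n_apply_le_of_hasL2Majorant blk hRN y' u hu
      refine h1.trans (mul_le_mul_of_nonneg_right ?_ (l2n_nonneg u))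
      calc ∑ z : g.Site, (θ * c) ^ N * Real.exp (-((1 - α) * δ₀ * g.dist z y'))
          ≤ ∑ _z : g.Site, q ^ N := Finset.sum_le_sum fun z _ => by
            have : Real.exp (-((1 - α) * δ₀ * g.dist z y')) ≤ 1 := by
              rw [Real.exp_le_one_iff]
              have := mul_nonneg hαδ (hdnn z y')
              linarith
            simpa [hq] using mul_le_mul_of_nonneg_left this (pow_nonneg hq0 N)
        _ = S * q ^ N := by rw [Finset.sum_const, Finset.card_univ, nsmul_eq_mul]
    have hrem : l2n (blockPiece blk y ((G' * R ^ N) u)) ≤ E * (S * q ^ N * l2n u) := by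
      rw [Module.End.mul_apply]
      exact (l2n_blockPiece_le blk y _).trans ((hEb _).trans (mul_le_mul_of_nonneg_left hglob hE))
    have hsplit : blockPiece blk y (G' u) =
        blockPiece blk y ((∑ n ∈ Finset.range N, G0 * R ^ n) u) + blockPiece blk y ((G' * R ^ N) u) := by
      conv_lhs => rw [fixedPoint_telescope hfix N]
      rw [LinearMap.add_apply, blockPiece_add]
    rw [hsplit]
    refine (l2n_add_le _ _).trans ?_
    have h1 : l2n (blockPiece blk y ((∑ n ∈ Finset.range N, G0 * R ^ n) u)) ≤ C := by simpa [hC, hq] using hSum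
    nlinarith [hrem, h1]
  have hlim : Filter.Tendsto (fun N : ℕ => C + E * S * l2n u * q ^ N) Filter.atTop (nhds (C + E * S * l2n u * 0)) :=
    ((tendsto_pow_atTop_nhds_zero_of_lt_one hq0 hsmall).const_mul (E * S * l2n u)).const_add C
  rw [mul_zero, add_zero] at hlim
  have := ge_of_tendsto' hlim hN
  simpa [hC, hq] using this

/-- **Prop. 2.6, the `L²` entries of (2.140), "reasoning in the same way as in the proof of Proposition 2.2", WITH THE GENERIC LEMMA-2.1 CONSTANT**
(the `ℓ²` twin of r03's `…B6Prop26ChainGeneric.prop26_chain_2136With`): at the rate `½δ₂`, `G = G₀ + GR` with `HasL2Majorant G₀ (A·P·e^{−½δ₂d})`,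
`HasL2Majorant R (θe^{−½δ₂d})`, (2.61)/(2.63) with constant `c ≥ 0` and `θc < 1` ⟹ `HasL2Majorant G (A·c·(1 − θc)⁻¹·P(y)·e^{−δ₃d})`, `δ₃ = delta3 α δ₂`.
[cite: Balaban1984PropagatorsII, Prop. 2.6 (2.140)–(2.141) p.247; Lemma 2.1 p.234] -/
theorem prop26_chain_2140With [DecidableEq X] (c δ₂ α θ A : ℝ)
    (P : g.Site → ℝ) (hc : 0 ≤ c) (hA : 0 ≤ A) (hP : ∀ y, 0 ≤ P y) (hθ : 0 ≤ θ) (hα : α ≤ 1) (hδ₂ : 0 ≤ δ₂)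
    (htri : Triangle254 g) (hrefl : ∀ y : g.Site, g.dist y y = 0) (hdnn : ∀ y y' : g.Site, 0 ≤ g.dist y y')
    (h261 : Ineq261With c g (δ₂ / 2) α) (h263 : Ineq263With c g (δ₂ / 2) α) (hsmall : θ * c < 1)
    {G G0 R : Module.End ℝ (X → ℝ)}
    (hG0 : HasL2Majorant blk G0 (fun a b => A * P a * Real.exp (-(δ₂ / 2 * g.dist a b))))
    (hR : HasL2Majorant blk R (fun a b => θ * Real.exp (-(δ₂ / 2 * g.dist a b)))) (hfix : G = G0 + G * R) :
    HasL2Majorant blk G (fun a b => A * c * (1 - θ * c)⁻¹ * P a * Real.exp (-(delta3 α δ₂ * g.dist a b))) := by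
  have hαδ : 0 ≤ (1 - α) * (δ₂ / 2) := mul_nonneg (by linarith) (by linarith)
  have h := l2Majorant_of_fixedPoint_266W blk c (δ₂ / 2) α θ A P hA hP hθ hc hαδ htri hrefl hdnn h261 h263 hsmall
    hG0 hR hfix
  intro y y' u hu
  have := h y y' u hu
  simpa [delta3, mul_assoc] using this

end ChainW

/-! ## §2  The pair input in PRODUCT form `K_{□,□′}G_{□′}h_{□′}` -/

section ProductPair

variable (blk : X → g.Site)

/-- INPUT LOCALISATION read off the product: if `h` is supported over the blocks of `S′`, a block-`ℓ²` majorant `K ≥ 0` of `T·h` improves to `1_{S′}(y′)·K(y,y′)`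
(an input piece in a block outside `S′` is killed by `h`). [cite: Balaban1984PropagatorsII, (2.91) p.239 (bookkeeping, ours)] -/
theorem hasL2Majorant_localise_in_of_mul {T : Module.End ℝ (X → ℝ)} {K : g.Site → g.Site → ℝ} {h : X → ℝ} {S' : Set g.Site}
    (hT : HasL2Majorant blk (T * mulOp h) K) (hK : ∀ a b, 0 ≤ K a b) (hsupp : ∀ x, h x ≠ 0 → blk x ∈ S') :
    HasL2Majorant blk (T * mulOp h) (fun a b => ind S' b * K a b) := by
  classical
  intro y y' u hu
  beta_reduce
  by_cases hy' : y' ∈ S'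
  · rw [ind_of_mem hy', one_mul]; exact hT y y' u hu
  · rw [Module.End.mul_apply, mulOp_eq_zero_of_support blk hsupp hu hy', map_zero]
    have h0 : blockPiece blk y (0 : X → ℝ) = 0 := by funext x; by_cases hx : blk x = y <;> simp [blockPiece, hx]
    rw [h0, l2n_zero]
    exact mul_nonneg (mul_nonneg (ind_nonneg _ _) (hK _ _)) (l2n_nonneg u)

open Classical in
/-- **(2.134) + (2.91) ⟹ (2.135) IN `L²`, PRODUCT FORM**: if every product `K_{□,□′}G_{□′}h_{□′}` has the block-`ℓ²` majorant `K ≥ 0` (from the sup bounds (2.134)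
of the product and of its transpose through `…B6RandomWalkL2Schur`), `K_{□,□′}G_{□′}` is output-localised to `S_□` and `h_{□′}` is supported over the blocks of
`S_□′`, then `R = Σ_{□,□′}K_{□,□′}G_{□′}h_{□′}` has the block-`ℓ²` majorant `N²·K`. [cite: Balaban1984PropagatorsII, (2.91)–(2.93) p.239 + (2.134)–(2.135) p.247] -/
theorem l2Majorant_R_of_2134_mul {C : Type} (D : Finset C) (S : C → Set g.Site) (N : ℕ)
    (hN : ∀ a : g.Site, (D.filter fun c => a ∈ S c).card ≤ N)
    (h : C → X → ℝ) (hsupp : ∀ c ∈ D, ∀ x, h c x ≠ 0 → blk x ∈ S c)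
    (Kt : C → C → Module.End ℝ (X → ℝ)) (K : g.Site → g.Site → ℝ) (hK : ∀ a b, 0 ≤ K a b)
    (h2134 : ∀ c ∈ D, ∀ c' ∈ D, HasL2Majorant blk (Kt c c' * mulOp (h c')) K)
    (hKout : ∀ c ∈ D, ∀ c' ∈ D, OutLoc blk (Kt c c') (S c)) :
    HasL2Majorant blk (∑ c ∈ D, ∑ c' ∈ D, Kt c c' * mulOp (h c')) (fun a b => (N : ℝ) ^ 2 * K a b) := by
  refine hasL2Majorant_sum_pairs_overlap blk D S _ K hK (fun c hc c' hc' => ?_) N hN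
  have h1 : HasL2Majorant blk (Kt c c' * mulOp (h c')) (fun a b => ind (S c') b * K a b) :=
    hasL2Majorant_localise_in_of_mul blk (h2134 c hc c' hc') hK (hsupp c' hc')
  have h2 := hasL2Majorant_localise_out blk h1 (fun a b => mul_nonneg (ind_nonneg _ _) (hK a b))
    (B6Prop26Gluing.outLoc_mul blk (hKout c hc c' hc') _)
  exact hasL2Majorant_mono blk h2 fun a b => le_of_eq (by ring)

end ProductPair

/-! ## §3  End to end with the generic constant -/

section EndToEndW

variable (blk : X → g.Site)

open Classical in
/-- **Prop. 2.6, an `L²` entry of (2.140), from the PER-BOX inputs, WITH THE GENERIC LEMMA-2.1 CONSTANT** (the `ℓ²` twin of r03's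
`…B6Prop26ChainGeneric.prop26_2136_of_2133_2134With` / of `…B6RandomWalkL2Gluing.prop26_2140_of_l2legs`): boxes `𝒟` with reaches `S_□` of overlap number `N`;
per-box operators `T_□` with block-`ℓ²` legs `1_{S_□}(y)·A·P(y)·e^{−½δ₂d}`; pair operators `K_{□,□′}G_{□′}` output-localised to `S_□`, partition functions `h_{□′}`
supported over `S_□′`, and the block-`ℓ²` bound `θ₀e^{−½δ₂d}` OF THE PRODUCTS `K_{□,□′}G_{□′}h_{□′}`; `G₀ = Σ_□ T_□`, `R = Σ_{□,□′}K_{□,□′}G_{□′}h_{□′}`, `G = G₀ + GR`;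
(2.54), `d(y,y) = 0`, `d ≥ 0`, (2.61)/(2.63) with constant `c ≥ 0`, `N²θ₀·c < 1` ⟹ `HasL2Majorant G ((N·A)·c·(1 − N²θ₀c)⁻¹·P(y)·e^{−δ₃d})`, `δ₃ = delta3 α δ₂`.
[cite: Balaban1984PropagatorsII, Prop. 2.6 (2.140)–(2.141) p.247; (2.90)–(2.91) p.239; (2.133)–(2.135) p.247; Lemma 2.1 p.234] -/
theorem prop26_2140_of_l2legsWith [DecidableEq X] (c δ₂ α θ₀ A : ℝ) (P : g.Site → ℝ)
    (hc : 0 ≤ c) (hA : 0 ≤ A) (hP : ∀ y, 0 ≤ P y) (hθ₀ : 0 ≤ θ₀) (hα : α ≤ 1) (hδ₂ : 0 ≤ δ₂)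
    (htri : Triangle254 g) (hrefl : ∀ y : g.Site, g.dist y y = 0) (hdnn : ∀ y y' : g.Site, 0 ≤ g.dist y y')
    (h261 : Ineq261With c g (δ₂ / 2) α) (h263 : Ineq263With c g (δ₂ / 2) α)
    {C : Type} (D : Finset C) (S : C → Set g.Site) (N : ℕ) (hN : ∀ a : g.Site, (D.filter fun i => a ∈ S i).card ≤ N)
    (hsmall : ((N : ℝ) ^ 2 * θ₀) * c < 1)
    (T : C → Module.End ℝ (X → ℝ))
    (hlegs : ∀ i ∈ D, HasL2Majorant blk (T i) (fun a b => ind (S i) a * (A * P a * Real.exp (-(δ₂ / 2 * g.dist a b)))))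
    (h : C → X → ℝ) (hsupp : ∀ i ∈ D, ∀ x, h i x ≠ 0 → blk x ∈ S i)
    (Kt : C → C → Module.End ℝ (X → ℝ))
    (h2134 : ∀ i ∈ D, ∀ i' ∈ D, HasL2Majorant blk (Kt i i' * mulOp (h i')) (fun a b => θ₀ * Real.exp (-(δ₂ / 2 * g.dist a b))))
    (hKout : ∀ i ∈ D, ∀ i' ∈ D, OutLoc blk (Kt i i') (S i))
    {G G0 R : Module.End ℝ (X → ℝ)} (hG0 : G0 = ∑ i ∈ D, T i) (hR : R = ∑ i ∈ D, ∑ i' ∈ D, Kt i i' * mulOp (h i'))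
    (hfix : G = G0 + G * R) :
    HasL2Majorant blk G (fun a b => (N * A) * c * (1 - (N : ℝ) ^ 2 * θ₀ * c)⁻¹ * P a * Real.exp (-(delta3 α δ₂ * g.dist a b))) := by
  have hKG : ∀ a b : g.Site, 0 ≤ A * P a * Real.exp (-(δ₂ / 2 * g.dist a b)) := fun a b =>
    mul_nonneg (mul_nonneg hA (hP a)) (Real.exp_nonneg _)
  have hKR : ∀ a b : g.Site, 0 ≤ θ₀ * Real.exp (-(δ₂ / 2 * g.dist a b)) := fun a b => mul_nonneg hθ₀ (Real.exp_nonneg _)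
  have hG0' : HasL2Majorant blk G0 (fun a b => (N * A) * P a * Real.exp (-(δ₂ / 2 * g.dist a b))) := by
    rw [hG0]
    refine hasL2Majorant_mono blk (l2Majorant_G0_of_legs blk D S N hN T _ hKG hlegs) fun a b => le_of_eq ?_
    ring
  have hR' : HasL2Majorant blk R (fun a b => ((N : ℝ) ^ 2 * θ₀) * Real.exp (-(δ₂ / 2 * g.dist a b))) := by
    rw [hR]
    refine hasL2Majorant_mono blk (l2Majorant_R_of_2134_mul blk D S N hN h hsupp Kt _ hKR h2134 hKout) fun a b => le_of_eq ?_
    ring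
  have hmain := prop26_chain_2140With blk c δ₂ α ((N : ℝ) ^ 2 * θ₀) (N * A) P hc (mul_nonneg (Nat.cast_nonneg N) hA) hP
    (mul_nonneg (sq_nonneg _) hθ₀) hα hδ₂ htri hrefl hdnn h261 h263 hsmall hG0' hR' hfix
  refine hasL2Majorant_mono blk hmain fun a b => le_of_eq ?_
  ring

end EndToEndW

end Literature.MathematicalPhysics.QuantumFieldTheory.Balaban1983to89.B6RandomWalkL2ChainWith
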